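import Mathlib

/-!
# Stub `stub_katzTruncationModular` (line `Sketch-ideate-r1-k1`, crux stmt-Langlands-8485)

The Katz truncation `T_M := Σ_{i ≤ M} c_i · E_{p-1}^{M-i}` of a Katz datum (`c_i` the
`q`-expansion of a classical form `F_i` of weight `k + i(p-1)` on `Γ₁(N)`, `E_{p-1}` Mathlib's
normalised level-one Eisenstein series `ModularForm.E`) is the `q`-expansion of a classical modular
form of weight `k + M(p-1)` on `Γ₁(N)`.

Proof: restrict `E_{p-1}` from `SL₂(ℤ)` to `Γ₁(N)` (same function on `ℍ`, so same `q`-expansion),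
then induct on `M` with `T_{M+1} := T_M · E_{p-1} + F_{M+1}` (Mathlib `ModularForm.mul`,
`ModularForm.mcast`, `ModularForm.qExpansion_add/_mul/_mcast`, period `1 ∈ strictPeriods Γ₁(N)`
from `CongruenceSubgroup.strictPeriods_Gamma1`).
-/

set_option linter.dupNamespace false

noncomputable section

open scoped MatrixGroups

namespace Summit.Langlands.Langlands.Theorems.HilbertIntegralOverconvergentIsCongruence

/-- **Katz truncations are classical.**  If `c i` is the `q`-expansion (period `1`) of a modular
form of weight `k + i(p-1)` on `Γ₁(N)` for every `i`, then for every `M` the truncation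
`Σ_{i ≤ M} c_i · E_{p-1}^{M-i}` is the `q`-expansion of a modular form of weight `k + M(p-1)` on
`Γ₁(N)` (`E_{p-1}` restricted from level one to `Γ₁(N)`; products and sums of modular forms;
Mathlib's `q`-expansion ring-hom identities). [folklore] -/
theorem stub_katzTruncationModular :
    ∀ (p : ℕ) [Fact p.Prime] (hp : 5 ≤ p) (N : ℕ) [NeZero N] (k : ℤ) (c : ℕ → PowerSeries ℂ),
      (∀ i : ℕ, ∃ F : ModularForm (CongruenceSubgroup.Gamma1 N) (k + i * (p - 1 : ℕ)),
        c i = UpperHalfPlane.qExpansion 1 ⇑F) →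
      ∀ M : ℕ, ∃ T : ModularForm (CongruenceSubgroup.Gamma1 N) (k + M * (p - 1 : ℕ)),
        UpperHalfPlane.qExpansion 1 ⇑T = ∑ i ∈ Finset.range (M + 1),
          c i * (UpperHalfPlane.qExpansion 1 ⇑(ModularForm.E (show 3 ≤ p - 1 by omega))) ^ (M - i) := by
  intro p _ hp N _ k c hc M
  -- `1` is a strict period of `Γ₁(N)`.
  have hΓ : (1 : ℝ) ∈
      (CongruenceSubgroup.Gamma1 N : Subgroup (GL (Fin 2) ℝ)).strictPeriods := by
    rw [CongruenceSubgroup.strictPeriods_Gamma1]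
    exact AddSubgroup.mem_zmultiples 1
  -- `Γ₁(N) ≤ SL₂(ℤ)` inside `GL₂(ℝ)`.
  have hle : (CongruenceSubgroup.Gamma1 N : Subgroup (GL (Fin 2) ℝ)) ≤ 𝒮ℒ := by
    rintro _ ⟨g, -, rfl⟩
    exact ⟨g, rfl⟩
  -- Restrict `E_{p-1}` to `Γ₁(N)` without changing the underlying function.
  obtain ⟨E', hE'⟩ : ∃ E' : ModularForm (CongruenceSubgroup.Gamma1 N) ((p - 1 : ℕ) : ℤ),
      (⇑E' : UpperHalfPlane → ℂ) = ⇑(ModularForm.E (show 3 ≤ p - 1 by omega)) :=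
    ⟨{ toFun := ⇑(ModularForm.E (show 3 ≤ p - 1 by omega))
       slash_action_eq' := fun γ hγ ↦
         SlashInvariantFormClass.slash_action_eq (ModularForm.E (show 3 ≤ p - 1 by omega)) γ (hle hγ)
       holo' := (ModularForm.E (show 3 ≤ p - 1 by omega)).holo'
       bdd_at_cusps' := fun hc' ↦
         (ModularForm.E (show 3 ≤ p - 1 by omega)).bdd_at_cusps' (hc'.mono hle) }, rfl⟩
  rw [← hE']
  induction M with
  | zero =>
    obtain ⟨F, hF⟩ := hc 0
    exact ⟨F, by simp [hF]⟩
  | succ M ih =>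
    obtain ⟨T, hT⟩ := ih
    obtain ⟨F, hF⟩ := hc (M + 1)
    have hw : k + (M : ℤ) * ((p - 1 : ℕ) : ℤ) + ((p - 1 : ℕ) : ℤ) =
        k + ((M + 1 : ℕ) : ℤ) * ((p - 1 : ℕ) : ℤ) := by
      push_cast
      ring
    refine ⟨ModularForm.mcast hw (T.mul E') + F, ?_⟩
    rw [ModularForm.coe_add, ModularForm.qExpansion_add one_pos hΓ, ModularForm.qExpansion_mcast,
      ModularForm.qExpansion_mul one_pos hΓ, hT, ← hF, Finset.sum_range_succ _ (M + 1),
      Nat.sub_self, pow_zero, mul_one, Finset.sum_mul]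
    congr 1
    refine Finset.sum_congr rfl fun i hi ↦ ?_
    rw [Finset.mem_range] at hi
    rw [mul_assoc, ← pow_succ, Nat.sub_add_comm (Nat.lt_succ_iff.mp hi)]

end Summit.Langlands.Langlands.Theorems.HilbertIntegralOverconvergentIsCongruence

end
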